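import Summits.QuantumFields.BalabanUV.T4Continuum.Support.NE7QbarIterPointwiseB8
import Summits.QuantumFields.BalabanUV.T4Continuum.Support.NE7SliceDirectLettersNL0
import HarnessLib

/-!
# NE7QbarIterPointwiseDbar — THE POINTWISE (sup) DIRECT LETTER OF THE COARSE DATUM: under `hdbar` alone, and AT THE (R1″) REPRESENTATIVE —
# `sup_{z,κ} ‖φ̃(u) z κ‖ ≤ 64(1+θ₂)·C₁L²d(4L+1)^d·((Lᵏ)²(Lᵏ)^{−d}·M²)·‖X(u)‖_w²` (`M = L^{k+1}`; at `d = 4` the weight is `L²`): NO sup factor of `X`, quadratic in the ENERGY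

Cell `pub-balaban`, rung (B)+1 sub-cell t4; row-NE7b owner lineage `b2b-balaban-t4-ne7b-p1` (gen 155), JUNCTION SERVICE for row NE7's open socket piece (S-g′) of ROAD-G107 §4
(journal [NE7bP1-G155-FINDING-1], exit (a); files 1–2∕3: `NE7QbarIterPointwiseB8Prep`, `NE7QbarIterPointwiseB8`; Literature: `B7Ineq146General`).
WHY.  `decomp_of_nl0_pair`'s normal part is `X_N = R₀φ̃`, `φ̃ = coarseDatumNL 2 k Us U' u`; its sup (hence, trivially, its covariant gradient) is `≤ supC0∕(M(1−θ_c))·sup‖φ̃‖`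
(`NE7FrameFreeRightInverse.norm_rightInvW0_le`).  The tree's direct letters (`NE7SliceDirectLettersNL0.directLetter_L1∕L2_nl0`) give `φ̃` in ℓ¹∕ℓ² with ONE sup factor `M·b`;
the pointwise tower (file 2∕3) gives `φ̃` AT EVERY BOND against `‖X‖²_{ℓ²}·(Lᵏ)^{2−d}` — at `d = 4` one power of `M⁻¹` better in the END currency, so that `sup‖X_N‖ = O(θ^{54k})` and
(Gᶜ_w) holds for `X_N` by the trivial bound `‖Ad(…)X_N(x+e_μ) − X_N(x)‖ ≤ 2·sup‖X_N‖` (FINDING-1 (F3)).  THIS FILE is the two thin layers the road's re-issue of the decomposition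
consumes BY NAME: the `hdbar` layer (twin of `NE7DbarQbarLetters.directLetter_L2_of_dbar`) and the (R1″)-representative layer (twin of `NE7SliceDirectLettersNL0.directLetter_L2_nl0`),
plus the `d = 4` reading of the weight.
WHAT ([folklore]; 0 def, 0 sorry).  §1 `norm_QbarIter_le_pointwise_of_dbar`, **`directLetter_sup_of_dbar`** (energy currency); §2 **`directLetter_sup_nl0`** (hypotheses = those of
`directLetter_L2_nl0` VERBATIM + the k-free line `8d·thetaGen d L (2α₀)·L⁻⁴ ≤ 1`); §3 `weight_d4` (`(Lᵏ)²((Lᵏ)⁴)⁻¹·(L^{k+1})² = L²`) and `directLetter_sup_nl0_d4`.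
HONEST FRAMING (page 1): composition of landed kernel theorems of rows NE3∕NE7 and [B7]∕[B8] AS TYPED; nothing of Bałaban's asserted as an axiom; the consumer ((S-g′): the re-issue of
`decomp_of_nl0_pair` exporting `sup‖X_N‖`, then (Gᶜ_w)) is the road's; NE3∕NE7 NOT proved; row NE7b (`T4WeightBudget.RelWeightBound`) NOT PRINTED ∕ NOT PROVED; spine count =
dagwriter's call; finite T⁴ rung (B)+1 — NOT infinite volume, NOT mass gap, NOT BetaPertH, NOT Clay (continuum YM on T⁴ ⇐ BetaPertH ∧ nine spine estimates).
-/

set_option autoImplicit false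

open scoped BigOperators Matrix Matrix.Norms.L2Operator
open NormedSpace Finset

namespace Summit.QuantumFields.BalabanUV.T4Continuum.NE7QbarIterPointwiseDbar

open Literature.MathematicalPhysics.QuantumFieldTheory.Balaban1983to89
open B7Prop1Explicit B7Prop2Explicit B7Prop3Flat MatrixLog
open B7Prop5GeneralLevels (thetaGen)
open B7Eq92Concrete (vcov dbavgCovIter)
open T4AveragingDeficitWall (IsUnitaryCfg IsSkewDir SmallField vary dirL1 dirSq)
open T4AveragingDeficitWallBoundary (IsPeriodicCfg periodBox)
open AveragingDeficitPeriodicCounting (IsPeriodicDir)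
open AveragingDeficitMultiLevelPrep (cavgIter LevelSmall tower)
open NE3EnergyShapes (IsUnitarySite IsPeriodicSite)
open NE3TangentCovariantTower (QbarIter)
open NE3FramePotBoundW (tower_eq_pow_mul)
open NE3CovariantLineSumsL2 (l2sq l2sq_nonneg)
open NE3.PairLandauB8Avg (relPert)
open NE3.QbarDictionary (adField relPert_eq_expCfg_adField)
open ReplicationRightInverseBound (radSum)
open BlockAverageVaryHolo (nbRad)
open NE3CovariantLineSumsError (Csup)
open ShellMeasureAverageProp4General (C1cov C1cov_pos)
open NE3EnergyWeightedShapes (energyNormW energyNormW_nonneg)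
open NE7SliceIterationState (repLog cornerLog)
open NE7SliceIterationStateNL (coarseDatumNL)
open NE7SliceIterationStateFacts (repLog_periodic)
open NE7SliceRepresentativeDbar (coarseDatumNL_eq_QbarIter_of_mlog_vcov_eq)
open NE7SliceDirectLettersNL0 (hdbar_nl0)
open NE7TopNormalisedQbarLetters (inv_sq_mul_l2sq_le_energySq)
open NE7QbarIterPointwiseB8 (norm_QbarIter_le_pointwise)

noncomputable section

variable {d : ℕ} {n : Type*} [Fintype n] [DecidableEq n] [Nonempty n]

/-! ## §1 Under `hdbar` alone -/

/-- **THE POINTWISE TOWER UNDER `hdbar`** (`dbavgCovIter L W (relPert W X) (j+1) = 1` is DEFINITIONALLY the (1.37) hypothesis of `norm_QbarIter_le_pointwise`, `relPert W X =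
expCfg (Ad_W X)`): for every `z κ`, `‖QbarIter L (j+1) W X z κ‖ ≤ 64(1+θ₂)·C₁L²d(4L+1)^d·(Lʲ)²((Lʲ)^d)⁻¹·l2sq (periodBox (N·L^{j+1})) X`, `θ₂ = thetaGen d L (2α₀)`. [folklore] -/
theorem norm_QbarIter_le_pointwise_of_dbar {L N : ℕ} (hL : 2 ≤ L) (hN : 1 ≤ N) (j : ℕ)
    {W : Site d → Fin d → (Matrix n n ℂ)ˣ} {x : ℝ} (hWu : IsUnitaryCfg W) (hWP : IsPeriodicCfg W ((N * L ^ (j + 1) : ℕ) : ℤ))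
    (hx : 0 ≤ x) (hsm : LevelSmall d L j x) (hWx : SmallField W x)
    {α₀ b : ℝ} (hα : 0 < α₀) (hα3 : C0 d * (2 * α₀) ≤ 1 / 3) (hα4 : 4 * (2 * α₀) ≤ c2' d L)
    (h52 : pdev W < α₀ * (((L : ℝ) ^ (j + 1))⁻¹) ^ 2) (hb : 0 ≤ b)
    {X : Site d → Fin d → Matrix n n ℂ} (hX : ∀ (y : Site d) (κ : Fin d), ‖X y κ‖ ≤ b) (hXP : IsPeriodicDir X ((N * L ^ (j + 1) : ℕ) : ℤ))
    (hsmall : Real.exp (4 * (800 * ((d : ℝ) + 1) ^ 2 * ((d : ℝ) + 4)) * α₀)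
      * (1 + 8 * (131072 * ((d : ℝ) + 1) ^ 2) * ((L : ℝ) ^ (j + 1) * b)) ≤ 2)
    (hc₃ : 4 * ((L : ℝ) ^ (j + 1) * b) ≤ c3 d L)
    (hK : 16 * (C1cov d * (L : ℝ) ^ 2 * Real.sqrt (d * (2 * (2 * L) + 1) ^ d)) * (L : ℝ) ^ (j + 1) * b ≤ Real.sqrt ((L : ℝ) ^ 2 / (L : ℝ) ^ d))
    (h145' : 8 * d * thetaGen d L (2 * α₀) * (L : ℝ)⁻¹ ^ 4 ≤ 1)
    (hdbar : dbavgCovIter L W (relPert W X) (j + 1) = 1) (z : Site d) (κ : Fin d) :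
    ‖QbarIter L (j + 1) W X z κ‖
      ≤ 64 * (1 + thetaGen d L (2 * α₀)) * (C1cov d * (L : ℝ) ^ 2 * (d * (2 * (2 * L) + 1) ^ d))
          * (((L : ℝ) ^ j) ^ 2 * ((((L : ℝ) ^ j) ^ d))⁻¹) * l2sq (periodBox (d := d) (N * L ^ (j + 1))) X := by
  have hdbar' : dbavgCovIter L W (expCfg (adField W X)) (j + 1) = 1 := by rwa [relPert_eq_expCfg_adField] at hdbar
  exact norm_QbarIter_le_pointwise hL hN j hWu hWP hx hsm hWx hα hα3 hα4 h52 hb hX hXP hsmall hc₃ hK h145' hdbar' z κ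

/-- **THE sup DIRECT LETTER UNDER `hdbar`, IN THE ENERGY CURRENCY** (`l2sq X ≤ (L^{j+1})²·‖X‖_w²`, `NE7TopNormalisedQbarLetters.inv_sq_mul_l2sq_le_energySq`): for every `z κ`,
`‖QbarIter L (j+1) W X z κ‖ ≤ 64(1+θ₂)·C₁L²d(4L+1)^d·((Lʲ)²((Lʲ)^d)⁻¹·(L^{j+1})²)·‖X‖_w²`. [folklore] -/
theorem directLetter_sup_of_dbar {L N : ℕ} (hL : 2 ≤ L) (hN : 1 ≤ N) (j : ℕ)
    {W : Site d → Fin d → (Matrix n n ℂ)ˣ} {x : ℝ} (hWu : IsUnitaryCfg W) (hWP : IsPeriodicCfg W ((N * L ^ (j + 1) : ℕ) : ℤ))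
    (hx : 0 ≤ x) (hsm : LevelSmall d L j x) (hWx : SmallField W x)
    {α₀ b : ℝ} (hα : 0 < α₀) (hα3 : C0 d * (2 * α₀) ≤ 1 / 3) (hα4 : 4 * (2 * α₀) ≤ c2' d L)
    (h52 : pdev W < α₀ * (((L : ℝ) ^ (j + 1))⁻¹) ^ 2) (hb : 0 ≤ b)
    {X : Site d → Fin d → Matrix n n ℂ} (hX : ∀ (y : Site d) (κ : Fin d), ‖X y κ‖ ≤ b) (hXP : IsPeriodicDir X ((N * L ^ (j + 1) : ℕ) : ℤ))
    (hsmall : Real.exp (4 * (800 * ((d : ℝ) + 1) ^ 2 * ((d : ℝ) + 4)) * α₀)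
      * (1 + 8 * (131072 * ((d : ℝ) + 1) ^ 2) * ((L : ℝ) ^ (j + 1) * b)) ≤ 2)
    (hc₃ : 4 * ((L : ℝ) ^ (j + 1) * b) ≤ c3 d L)
    (hK : 16 * (C1cov d * (L : ℝ) ^ 2 * Real.sqrt (d * (2 * (2 * L) + 1) ^ d)) * (L : ℝ) ^ (j + 1) * b ≤ Real.sqrt ((L : ℝ) ^ 2 / (L : ℝ) ^ d))
    (h145' : 8 * d * thetaGen d L (2 * α₀) * (L : ℝ)⁻¹ ^ 4 ≤ 1)
    (hdbar : dbavgCovIter L W (relPert W X) (j + 1) = 1) (z : Site d) (κ : Fin d) :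
    ‖QbarIter L (j + 1) W X z κ‖
      ≤ 64 * (1 + thetaGen d L (2 * α₀)) * (C1cov d * (L : ℝ) ^ 2 * (d * (2 * (2 * L) + 1) ^ d))
          * (((L : ℝ) ^ j) ^ 2 * ((((L : ℝ) ^ j) ^ d))⁻¹ * ((L : ℝ) ^ (j + 1)) ^ 2)
          * energyNormW L (j + 1) W X (periodBox (d := d) (N * L ^ (j + 1))) ^ 2 := by
  have h := norm_QbarIter_le_pointwise_of_dbar hL hN j hWu hWP hx hsm hWx hα hα3 hα4 h52 hb hX hXP hsmall hc₃ hK h145' hdbar z κ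
  have hL0 : (0 : ℝ) < L := by exact_mod_cast (show 0 < L by omega)
  have hM2 : (0 : ℝ) < ((L : ℝ) ^ (j + 1)) ^ 2 := by positivity
  have hEn := inv_sq_mul_l2sq_le_energySq L j W X (periodBox (d := d) (N * L ^ (j + 1)))
  have hl2 : l2sq (periodBox (d := d) (N * L ^ (j + 1))) X ≤ ((L : ℝ) ^ (j + 1)) ^ 2 * energyNormW L (j + 1) W X (periodBox (d := d) (N * L ^ (j + 1))) ^ 2 := by
    rw [← div_le_iff₀' hM2, div_eq_inv_mul]; exact hEn
  have hθ0 : 0 ≤ thetaGen d L (2 * α₀) := by unfold thetaGen; positivity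
  have hC0 : 0 ≤ 64 * (1 + thetaGen d L (2 * α₀)) * (C1cov d * (L : ℝ) ^ 2 * (d * (2 * (2 * L) + 1) ^ d))
      * (((L : ℝ) ^ j) ^ 2 * ((((L : ℝ) ^ j) ^ d))⁻¹) := by have := C1cov_pos d; positivity
  calc ‖QbarIter L (j + 1) W X z κ‖
      ≤ 64 * (1 + thetaGen d L (2 * α₀)) * (C1cov d * (L : ℝ) ^ 2 * (d * (2 * (2 * L) + 1) ^ d))
          * (((L : ℝ) ^ j) ^ 2 * ((((L : ℝ) ^ j) ^ d))⁻¹) * l2sq (periodBox (d := d) (N * L ^ (j + 1))) X := h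
    _ ≤ 64 * (1 + thetaGen d L (2 * α₀)) * (C1cov d * (L : ℝ) ^ 2 * (d * (2 * (2 * L) + 1) ^ d))
          * (((L : ℝ) ^ j) ^ 2 * ((((L : ℝ) ^ j) ^ d))⁻¹)
          * (((L : ℝ) ^ (j + 1)) ^ 2 * energyNormW L (j + 1) W X (periodBox (d := d) (N * L ^ (j + 1))) ^ 2) := mul_le_mul_of_nonneg_left hl2 hC0
    _ = _ := by ring

/-! ## §2 At the (R1″) representative: the sup twin of `directLetter_L2_nl0` -/

section Letters

variable {L N : ℕ} (hL : 2 ≤ L) [NeZero N] (k : ℕ) {W : Site d → Fin d → (Matrix n n ℂ)ˣ} {x : ℝ} (hWu : IsUnitaryCfg W)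
  (hWP : IsPeriodicCfg W ((tower L N (k + 1) : ℕ) : ℤ)) (hx : 0 ≤ x) (hs : LevelSmall d L k x) (hWx : SmallField W x)
  -- [B7]'s Prop-4 regime at the radius `b`, in [B8]'s shape
  {α₀ b : ℝ} (hα : 0 < α₀) (hα3 : C0 d * (2 * α₀) ≤ 1 / 3) (hα4 : 4 * (2 * α₀) ≤ c2' d L) (h52 : pdev W < α₀ * (((L : ℝ) ^ (k + 1))⁻¹) ^ 2) (hb : 0 ≤ b)
  (hsmall : Real.exp (4 * (800 * ((d : ℝ) + 1) ^ 2 * ((d : ℝ) + 4)) * α₀) * (1 + 8 * (131072 * ((d : ℝ) + 1) ^ 2) * ((L : ℝ) ^ (k + 1) * b)) ≤ 2)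
  (hc₃ : 4 * ((L : ℝ) ^ (k + 1) * b) ≤ c3 d L) (hsm : 2048 * (d : ℝ) * ((L : ℝ) ^ (k + 1) * b) ≤ 1)
  (hK : 16 * (C1cov d * (L : ℝ) ^ 2 * Real.sqrt (d * (2 * (2 * L) + 1) ^ d)) * (L : ℝ) ^ (k + 1) * b ≤ Real.sqrt ((L : ℝ) ^ 2 / (L : ℝ) ^ d))
  -- the extra k-free line of the pointwise tower ([B7] (145) at the doubled plaquette constant of the level backgrounds)
  (h145' : 8 * d * thetaGen d L (2 * α₀) * (L : ℝ)⁻¹ ^ 4 ≤ 1)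
  -- the target configuration on the (S1) fibre, with its class data
  (U' : Site d → Fin d → (Matrix n n ℂ)ˣ) (hU'u : IsUnitaryCfg U') (hU'P : IsPeriodicCfg U' ((tower L N (k + 1) : ℕ) : ℤ))
  {x' : ℝ} (hx'0 : 0 ≤ x') (hs' : LevelSmall d L k x') (hU'x : SmallField U' x') (htop : cavgIter L (k + 1) U' = cavgIter L (k + 1) W)
  -- the state: unitary periodic, chart, corners, sizes, and (1.37) EXACTLY
  {u : Site d → (Matrix n n ℂ)ˣ} (hu : IsUnitarySite u) (huP : IsPeriodicSite u ((tower L N (k + 1) : ℕ) : ℤ))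
  (hgauge : gaugeAct u U' = vary W (repLog W U' u) 1) (hX8 : ∀ y κ, ‖repLog W U' u y κ‖ ≤ 1 / 8) (hXb : ∀ y κ, ‖repLog W U' u y κ‖ ≤ b)
  (hcorner : ∀ z, ((u (((L : ℤ) ^ (k + 1)) • z) : (Matrix n n ℂ)ˣ) : Matrix n n ℂ) = exp (cornerLog L k u z))
  (hv0 : ∀ z, mlog ((vcov L W (relPert W (repLog W U' u)) (k + 1) z : (Matrix n n ℂ)ˣ) : Matrix n n ℂ) = cornerLog L k u z)

include hL hWu hWP hx hs hWx hα hα3 hα4 h52 hb hsmall hc₃ hsm hK h145' hU'u hU'P hx'0 hs' hU'x htop hu huP hgauge hX8 hXb hcorner hv0 in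
/-- **THE sup DIRECT LETTER AT THE (R1″) REPRESENTATIVE**: for every coarse bond `(z, κ)`,
`‖φ̃(u) z κ‖ ≤ 64(1+θ₂)·C₁L²d(4L+1)^d·((Lᵏ)²((Lᵏ)^d)⁻¹·(L^{k+1})²)·‖X(u)‖_w²`, `φ̃(u) = coarseDatumNL L k W U′ u`, `X(u) = repLog W U′ u`, `‖·‖_w = energyNormW L (k+1) W · [0,N·M)^d`
(`1 ≤ N`; `φ̃ = QbarIter (k+1) W X` by `coarseDatumNL_eq_QbarIter_of_mlog_vcov_eq`, `hdbar` by `hdbar_nl0`). [folklore] -/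
theorem directLetter_sup_nl0 (hN : 1 ≤ N) (z : Site d) (κ : Fin d) :
    ‖coarseDatumNL L k W U' u z κ‖
      ≤ 64 * (1 + thetaGen d L (2 * α₀)) * (C1cov d * (L : ℝ) ^ 2 * (d * (2 * (2 * L) + 1) ^ d))
          * (((L : ℝ) ^ k) ^ 2 * ((((L : ℝ) ^ k) ^ d))⁻¹ * ((L : ℝ) ^ (k + 1)) ^ 2)
          * energyNormW L (k + 1) W (repLog W U' u) (periodBox (d := d) (N * L ^ (k + 1))) ^ 2 := by
  have hT : (tower L N (k + 1) : ℕ) = N * L ^ (k + 1) := by rw [tower_eq_pow_mul, Nat.mul_comm]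
  have hWP' : IsPeriodicCfg W ((N * L ^ (k + 1) : ℕ) : ℤ) := by rw [← hT]; exact hWP
  have hXP : IsPeriodicDir (repLog W U' u) ((N * L ^ (k + 1) : ℕ) : ℤ) := fun y i μ => by
    rw [← hT]; exact repLog_periodic k N U' hWP hU'P huP y i μ
  rw [coarseDatumNL_eq_QbarIter_of_mlog_vcov_eq hL k hWu hx hs hWx N U' hWP hU'u hU'P hu huP hgauge hX8 hv0]
  exact directLetter_sup_of_dbar hL hN k hWu hWP' hx hs hWx hα hα3 hα4 h52 hb hXb hXP hsmall hc₃ hK h145'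
    (hdbar_nl0 hL k hWu hα hα4 h52 hb hsmall hc₃ hsm U' hU'u hx'0 hs' hU'x htop hu hgauge hXb hcorner hv0 hα3) z κ

end Letters

/-! ## §3 The `d = 4` reading of the weight -/

omit [Fintype n] [DecidableEq n] [Nonempty n] in
/-- at `d = 4` the weight of the sup letter is `L²`: `(Lᵏ)²·((Lᵏ)⁴)⁻¹·(L^{k+1})² = L²` (`L > 0`). [folklore] -/
theorem weight_d4 {L : ℝ} (hL : 0 < L) (k : ℕ) : (L ^ k) ^ 2 * ((L ^ k) ^ 4)⁻¹ * (L ^ (k + 1)) ^ 2 = L ^ 2 := by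
  have hL0 : L ≠ 0 := hL.ne'
  have hk : (L ^ k) ≠ 0 := pow_ne_zero _ hL0
  rw [pow_succ]
  field_simp
  ring

/-- **THE sup DIRECT LETTER AT `d = 4`**: `‖φ̃(u) z κ‖ ≤ 64(1+θ₂)·C₁L²·4(4L+1)^4·L²·‖X(u)‖_w²` — quadratic in the ENERGY of `X`, NO sup factor; in the END currency of route 1 (`‖X‖_w ≤
C·residualScale = O(θ^{18k})`) this is `O(θ^{36k})`, whence `sup‖X_N‖ ≤ supC0∕(M(1−θ_c))·sup‖φ̃‖ = O(θ^{54k})` (FINDING-1 (F3)∕(F5)(a)). [folklore] -/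
theorem directLetter_sup_nl0_d4 {n : Type*} [Fintype n] [DecidableEq n] [Nonempty n]
    {L N : ℕ} (hL : 2 ≤ L) [NeZero N] (k : ℕ) {W : Site 4 → Fin 4 → (Matrix n n ℂ)ˣ} {x : ℝ} (hWu : IsUnitaryCfg W)
    (hWP : IsPeriodicCfg W ((tower L N (k + 1) : ℕ) : ℤ)) (hx : 0 ≤ x) (hs : LevelSmall 4 L k x) (hWx : SmallField W x)
    {α₀ b : ℝ} (hα : 0 < α₀) (hα3 : C0 4 * (2 * α₀) ≤ 1 / 3) (hα4 : 4 * (2 * α₀) ≤ c2' 4 L) (h52 : pdev W < α₀ * (((L : ℝ) ^ (k + 1))⁻¹) ^ 2) (hb : 0 ≤ b)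
    (hsmall : Real.exp (4 * (800 * (((4 : ℕ) : ℝ) + 1) ^ 2 * (((4 : ℕ) : ℝ) + 4)) * α₀) * (1 + 8 * (131072 * (((4 : ℕ) : ℝ) + 1) ^ 2) * ((L : ℝ) ^ (k + 1) * b)) ≤ 2)
    (hc₃ : 4 * ((L : ℝ) ^ (k + 1) * b) ≤ c3 4 L) (hsm : 2048 * ((4 : ℕ) : ℝ) * ((L : ℝ) ^ (k + 1) * b) ≤ 1)
    (hK : 16 * (C1cov 4 * (L : ℝ) ^ 2 * Real.sqrt ((4 : ℕ) * (2 * (2 * L) + 1) ^ 4)) * (L : ℝ) ^ (k + 1) * b ≤ Real.sqrt ((L : ℝ) ^ 2 / (L : ℝ) ^ 4))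
    (h145' : 8 * (4 : ℕ) * thetaGen 4 L (2 * α₀) * (L : ℝ)⁻¹ ^ 4 ≤ 1)
    (U' : Site 4 → Fin 4 → (Matrix n n ℂ)ˣ) (hU'u : IsUnitaryCfg U') (hU'P : IsPeriodicCfg U' ((tower L N (k + 1) : ℕ) : ℤ))
    {x' : ℝ} (hx'0 : 0 ≤ x') (hs' : LevelSmall 4 L k x') (hU'x : SmallField U' x') (htop : cavgIter L (k + 1) U' = cavgIter L (k + 1) W)
    {u : Site 4 → (Matrix n n ℂ)ˣ} (hu : IsUnitarySite u) (huP : IsPeriodicSite u ((tower L N (k + 1) : ℕ) : ℤ))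
    (hgauge : gaugeAct u U' = vary W (repLog W U' u) 1) (hX8 : ∀ y κ, ‖repLog W U' u y κ‖ ≤ 1 / 8) (hXb : ∀ y κ, ‖repLog W U' u y κ‖ ≤ b)
    (hcorner : ∀ z, ((u (((L : ℤ) ^ (k + 1)) • z) : (Matrix n n ℂ)ˣ) : Matrix n n ℂ) = exp (cornerLog L k u z))
    (hv0 : ∀ z, mlog ((vcov L W (relPert W (repLog W U' u)) (k + 1) z : (Matrix n n ℂ)ˣ) : Matrix n n ℂ) = cornerLog L k u z)
    (hN : 1 ≤ N) (z : Site 4) (κ : Fin 4) :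
    ‖coarseDatumNL L k W U' u z κ‖
      ≤ 64 * (1 + thetaGen 4 L (2 * α₀)) * (C1cov 4 * (L : ℝ) ^ 2 * ((4 : ℕ) * (2 * (2 * L) + 1) ^ 4)) * (L : ℝ) ^ 2
          * energyNormW L (k + 1) W (repLog W U' u) (periodBox (d := 4) (N * L ^ (k + 1))) ^ 2 := by
  have hL0 : (0 : ℝ) < L := by exact_mod_cast (show 0 < L by omega)
  have h := directLetter_sup_nl0 hL k hWu hWP hx hs hWx hα hα3 hα4 h52 hb hsmall hc₃ hsm hK h145' U' hU'u hU'P hx'0 hs' hU'x htop hu huP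
    hgauge hX8 hXb hcorner hv0 hN z κ
  rw [weight_d4 hL0 k] at h
  exact h

end

end Summit.QuantumFields.BalabanUV.T4Continuum.NE7QbarIterPointwiseDbar
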